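import Summits.Ventures.PackingBounds.Configurations.ListConfigTwoOrbit
import Summits.Ventures.PackingBounds.Conjectures.DiploSimplexRiesz
import Mathlib.NumberTheory.Zsqrtd.ToReal
import HarnessLib

/-!
# `(6, 14)`: the Petersen code ⊕ a square beats the diplo-simplex `D_6` for Riesz `s = 6, 8` (kernel); the competitor family `X_n`

Framing: lottery ticket; floor = certified bounds/negative ranges. Venture `PackingBounds` (cell `pub-packcert`, seat
`pub-packcert-energy`, gen 26) — kernel facts about the threshold `s*(6)` of Conjecture B (`Conjectures/DiploSimplexRiesz.lean`).

THE COMPETITOR FAMILY `X_n` (`n ≥ 5`, `2n + 2` points of `S^{n-1}`): the Petersen code (ten points `5(e_i + e_j) - 2·𝟙` in the `4`-space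
`𝟙^⊥ ⊂ ℝ⁵ ⊂ ℝⁿ`) together with a regular cross-polytope `β_{n-4}` (`2(n-4)` points) of the orthogonal complement `ℝ𝟙 ⊕ ℝ^{n-5}`; energy
`E_a(X_n) = 60 a(1/6) + 30 a(-2/3) + 2(n-4) a(-1) + [40(n-4) + 4(n-4)(n-5)] a(0)` (`X_5` = Petersen + poles, `Conjectures/DiploSimplexFive.lean`).
Closed-form crossovers `E_s(X_n) = E_s(D_n)` (float, seat gen 26): `s_c(5) = 2` (exact tie), `s_c(6) = 4.0866`, `s_c(7) = 6.057`, `s_c(8) = 8.218`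
(and back at `25.68`), `s_c(9) = 11.60` (back at `17.48`), none for `n ≥ 10` (`X_n` has the smaller minimal distance `√(5/3) < √(2 - 2/n)` for `n ≥ 7`).
So `X_n` bounds the Conjecture-B threshold from above for `5 ≤ n ≤ 9`: `s*(6) ≤ 4.09`, `s*(7) ≤ 6.06`, `s*(8) ≤ 8.22`, `s*(9) ≤ 11.6`; at the HARMONIC
exponent `s = n - 2` the diplo-simplex still wins against `X_n` for every `n ≥ 6` (margin `E_4(X_6) - E_4(D_6) = 46.55 - 46.5436 = 0.0064` at `n = 6`,
i.e. BBCGKS's 'n ≥ 6' survives this family by `1.4·10⁻⁴` relative), and loses for `n = 5` (`s = 3`). Multi-start numerics (seat work/negative): the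
`(6,14)` optimum is `D_6` at `s = 1, 4` and `X_6` at `s = 5, 6, 8`; `(7,16)`: `D_7` at `s = 5`, `X_7` at `s = 7`; `(8,18)`: `D_8` at `s = 8`.
THIS FILE (kernel, `n = 6`, coordinates over `ℤ[√5]` at scale `√30`: Petersen rows integral, the square `±(𝟙_5, 5)`, `±(√5·𝟙_5, -√5)`):
`SixPetersenSquare.energy_pts`; `E_6(X_6) = 9933/400 = 24.8325 < dipValue 6 6 = 24.97…` (`not_diploMinimises_six_six`);
`E_8(X_6) = 13.534625 < dipValue 6 8 = 13.77…` (`not_diploMinimises_six_eight`); and the harmonic comparison the other way,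
`dipValue 6 4 = 46.5435… < E_4(X_6) = 931/20` (`dipValue_six_four_lt_petersenSquare`). So `s*(6) < 6` in the kernel; Conjecture B asks `s*(6) ≥ 4`.

## References
* B. Ballinger et al., Experiment. Math. 18 (2009) 257–283, §3.4. [`BallingerEtAl2009`]
* J. H. Conway, N. J. A. Sloane, *Sphere Packings, Lattices and Groups*, Ch. 9 Table 9.2 (the Petersen code). [`ConwaySloane1999`]
-/

noncomputable section

open Finset
open scoped RealInnerProductSpace

namespace Summit.Ventures.PackingBounds.Conjectures

open Summit.Ventures.PackingBounds.Config

/-- For unit vectors: `‖x - y‖^{-(2k)} = ((2 - 2⟪x,y⟫)^k)⁻¹`. [folklore] -/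
private theorem norm_sub_rpow_neg_even {m : ℕ} {x y : EuclideanSpace ℝ (Fin m)} (hx : ‖x‖ = 1) (hy : ‖y‖ = 1) (k : ℕ) :
    ‖x - y‖ ^ (-((2 * k : ℕ) : ℝ)) = ((2 - 2 * inner ℝ x y) ^ k)⁻¹ := by
  have hsq : ‖x - y‖ ^ 2 = 2 - 2 * inner ℝ x y := by rw [norm_sub_sq_real, hx, hy]; ring
  rw [Real.rpow_neg (norm_nonneg _), Real.rpow_natCast, pow_mul, hsq]

/-- `√q ^ {-(2k)} = (q^k)⁻¹` for `q ≥ 0`. [folklore] -/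
private theorem sqrt_rpow_neg_even {q : ℝ} (hq : 0 ≤ q) (k : ℕ) : Real.sqrt q ^ (-((2 * k : ℕ) : ℝ)) = (q ^ k)⁻¹ := by
  rw [Real.rpow_neg (Real.sqrt_nonneg _), Real.rpow_natCast, pow_mul, Real.sq_sqrt hq]

namespace SixPetersenSquare

/-- `0 ≤ 5`. -/
private theorem hd : (0 : ℤ) ≤ 5 := by norm_num

/-- `5` is not a square. -/
private theorem d_not_square : ∀ n : ℤ, (5 : ℤ) ≠ n * n := by
  intro n h
  have h1 : n.natAbs * n.natAbs = 5 := by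
    have := Int.natAbs_mul_self' n; omega
  have h2 : n.natAbs ≤ 3 := by nlinarith
  interval_cases n.natAbs <;> omega

/-- `(√5)² = 5`. -/
private theorem hX : Real.sqrt 5 ^ 2 = 5 := Real.sq_sqrt (by norm_num)

/-- The Petersen code `5(e_i + e_j) - 2·𝟙_5` (`i < j`) in `ℝ⁵ × {0} ⊂ ℝ⁶`, squared norm `30`, over `ℤ[√5]`.
[cite: ConwaySloane1999, Ch. 9 Table 9.2] -/
def rows₁ : List (List (Zsqrtd 5)) := [
  [⟨3, 0⟩, ⟨3, 0⟩, ⟨-2, 0⟩, ⟨-2, 0⟩, ⟨-2, 0⟩, ⟨0, 0⟩],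
  [⟨3, 0⟩, ⟨-2, 0⟩, ⟨3, 0⟩, ⟨-2, 0⟩, ⟨-2, 0⟩, ⟨0, 0⟩],
  [⟨3, 0⟩, ⟨-2, 0⟩, ⟨-2, 0⟩, ⟨3, 0⟩, ⟨-2, 0⟩, ⟨0, 0⟩],
  [⟨3, 0⟩, ⟨-2, 0⟩, ⟨-2, 0⟩, ⟨-2, 0⟩, ⟨3, 0⟩, ⟨0, 0⟩],
  [⟨-2, 0⟩, ⟨3, 0⟩, ⟨3, 0⟩, ⟨-2, 0⟩, ⟨-2, 0⟩, ⟨0, 0⟩],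
  [⟨-2, 0⟩, ⟨3, 0⟩, ⟨-2, 0⟩, ⟨3, 0⟩, ⟨-2, 0⟩, ⟨0, 0⟩],
  [⟨-2, 0⟩, ⟨3, 0⟩, ⟨-2, 0⟩, ⟨-2, 0⟩, ⟨3, 0⟩, ⟨0, 0⟩],
  [⟨-2, 0⟩, ⟨-2, 0⟩, ⟨3, 0⟩, ⟨3, 0⟩, ⟨-2, 0⟩, ⟨0, 0⟩],
  [⟨-2, 0⟩, ⟨-2, 0⟩, ⟨3, 0⟩, ⟨-2, 0⟩, ⟨3, 0⟩, ⟨0, 0⟩],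
  [⟨-2, 0⟩, ⟨-2, 0⟩, ⟨-2, 0⟩, ⟨3, 0⟩, ⟨3, 0⟩, ⟨0, 0⟩]]

/-- The square (cross-polytope `β₂`) of the complement plane `ℝ𝟙_5 ⊕ ℝe₆`: `±(𝟙_5 + 5e₆)`, `±√5(𝟙_5 - e₆)` (squared norm `30`). -/
def rows₂ : List (List (Zsqrtd 5)) := [
  [⟨1, 0⟩, ⟨1, 0⟩, ⟨1, 0⟩, ⟨1, 0⟩, ⟨1, 0⟩, ⟨5, 0⟩],
  [⟨-1, 0⟩, ⟨-1, 0⟩, ⟨-1, 0⟩, ⟨-1, 0⟩, ⟨-1, 0⟩, ⟨-5, 0⟩],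
  [⟨0, 1⟩, ⟨0, 1⟩, ⟨0, 1⟩, ⟨0, 1⟩, ⟨0, 1⟩, ⟨0, -1⟩],
  [⟨0, -1⟩, ⟨0, -1⟩, ⟨0, -1⟩, ⟨0, -1⟩, ⟨0, -1⟩, ⟨0, 1⟩]]

/-- All coordinate lists (scale `√30`). -/
def vecs : List (List (Zsqrtd 5)) := rows₁ ++ rows₂

/-- Dot-product histogram of a Petersen row with the other rows: `5` (×6), `-20` (×3), `0` (×4, the square). -/
def table₁ : List ((Zsqrtd 5) × ℕ) := [(⟨5, 0⟩, 6), (⟨-20, 0⟩, 3), (⟨0, 0⟩, 4)]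

/-- Dot-product histogram of a square vertex with the other rows: `-30` (×1, its antipode), `0` (×12). -/
def table₂ : List ((Zsqrtd 5) × ℕ) := [(⟨-30, 0⟩, 1), (⟨0, 0⟩, 12)]

/-- Kernel check: `14` coordinate lists. -/
theorem length_vecs : vecs.length = 14 := by decide +kernel

/-- Kernel check: `10` Petersen rows. -/
theorem length_rows₁ : rows₁.length = 10 := by decide +kernel

/-- Kernel check: `4` square rows. -/
theorem length_rows₂ : rows₂.length = 4 := by decide +kernel

set_option maxRecDepth 100000 in
/-- Kernel check: every list has length `6` and squared length `30`. -/
theorem shape_vecs : shapeOK vecs 6 (⟨30, 0⟩ : (Zsqrtd 5)) = true := by decide +kernel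

/-- Kernel check: Petersen table keys distinct and `≠ q`. -/
theorem keys_table₁ : keysOK table₁ (⟨30, 0⟩ : (Zsqrtd 5)) = true := by decide +kernel

/-- Kernel check: square table keys distinct and `≠ q`. -/
theorem keys_table₂ : keysOK table₂ (⟨30, 0⟩ : (Zsqrtd 5)) = true := by decide +kernel

set_option maxRecDepth 100000 in
/-- Kernel check (Petersen rows' distance distribution). -/
theorem hist_rows₁ : histOK vecs table₁ rows₁ = true := by decide +kernel

set_option maxRecDepth 100000 in
/-- Kernel check (square rows' distance distribution). -/
theorem hist_rows₂ : histOK vecs table₂ rows₂ = true := by decide +kernel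

/-- The configuration `X_6`: the normalised coordinate lists as points of `ℝ⁶`. -/
noncomputable def pts : Finset (EuclideanSpace ℝ (Fin 6)) :=
  config (Zsqrtd.toReal hd) 6 (⟨30, 0⟩ : (Zsqrtd 5)) vecs

/-- `ι q > 0`. -/
theorem hq : 0 < (Zsqrtd.toReal hd) (⟨30, 0⟩ : (Zsqrtd 5)) := by
  rw [Zsqrtd.toReal_apply]; push_cast; nlinarith [Real.sqrt_nonneg 5, hX]

/-- Node value for the dot product `5`: inner product `1/6`. -/
theorem key_0 : (Zsqrtd.toReal hd) (⟨5, 0⟩ : (Zsqrtd 5)) / (Zsqrtd.toReal hd) (⟨30, 0⟩ : (Zsqrtd 5)) = (1 / 6 : ℝ) := by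
  rw [div_eq_iff hq.ne', Zsqrtd.toReal_apply, Zsqrtd.toReal_apply]
  push_cast
  ring

/-- Node value for the dot product `-20`: inner product `-2/3`. -/
theorem key_1 : (Zsqrtd.toReal hd) (⟨-20, 0⟩ : (Zsqrtd 5)) / (Zsqrtd.toReal hd) (⟨30, 0⟩ : (Zsqrtd 5)) = (-2 / 3 : ℝ) := by
  rw [div_eq_iff hq.ne', Zsqrtd.toReal_apply, Zsqrtd.toReal_apply]
  push_cast
  ring

/-- Node value for the dot product `0`: inner product `0`. -/
theorem key_2 : (Zsqrtd.toReal hd) (⟨0, 0⟩ : (Zsqrtd 5)) / (Zsqrtd.toReal hd) (⟨30, 0⟩ : (Zsqrtd 5)) = (0 : ℝ) := by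
  rw [div_eq_iff hq.ne', Zsqrtd.toReal_apply, Zsqrtd.toReal_apply]
  push_cast
  ring

/-- Node value for the dot product `-30`: inner product `-1`. -/
theorem key_3 : (Zsqrtd.toReal hd) (⟨-30, 0⟩ : (Zsqrtd 5)) / (Zsqrtd.toReal hd) (⟨30, 0⟩ : (Zsqrtd 5)) = (-1 : ℝ) := by
  rw [div_eq_iff hq.ne', Zsqrtd.toReal_apply, Zsqrtd.toReal_apply]
  push_cast
  ring

/-- `X_6` has `14` points. -/
theorem card_pts : pts.card = 14 := by
  rw [pts, card_eq₂ (Zsqrtd.toReal_injective hd d_not_square) hq shape_vecs keys_table₁ keys_table₂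
    hist_rows₁ hist_rows₂ rfl, length_vecs]

/-- Every point of `X_6` is a unit vector. -/
theorem norm_pts : ∀ x ∈ pts, ‖x‖ = 1 := norm_eq_one hq shape_vecs

/-- **Energy of `X_6`**: for every potential `a`, `Σ_{x ≠ y ∈ X_6} a(⟪x,y⟫) = 4 a(-1) + 88 a(0) + 60 a(1/6) + 30 a(-2/3)`. -/
theorem energy_pts (a : ℝ → ℝ) :
    ∑ x ∈ pts, ∑ y ∈ pts.erase x, a (inner ℝ x y) =
      4 * a (-1 : ℝ) + 88 * a 0 + 60 * a (1 / 6 : ℝ) + 30 * a (-2 / 3 : ℝ) := by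
  rw [pts, energy_eq₂ (Zsqrtd.toReal_injective hd d_not_square) hq shape_vecs keys_table₁ keys_table₂
    hist_rows₁ hist_rows₂ rfl a, length_rows₁, length_rows₂]
  simp only [table₁, table₂, List.map_cons, List.map_nil, List.sum_cons, List.sum_nil, Nat.cast_ofNat,
    Nat.cast_one]
  rw [key_0, key_1, key_2, key_3]
  ring

/-- **Riesz-`2k` energy of `X_6`** in closed form. -/
theorem riesz_even_pts (k : ℕ) : ∑ x ∈ pts, ∑ y ∈ pts.erase x, ‖x - y‖ ^ (-((2 * k : ℕ) : ℝ)) =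
    4 * ((4 : ℝ) ^ k)⁻¹ + 88 * ((2 : ℝ) ^ k)⁻¹ + 60 * (((5 : ℝ) / 3) ^ k)⁻¹ + 30 * (((10 : ℝ) / 3) ^ k)⁻¹ := by
  have hconv : ∑ x ∈ pts, ∑ y ∈ pts.erase x, ‖x - y‖ ^ (-((2 * k : ℕ) : ℝ)) =
      ∑ x ∈ pts, ∑ y ∈ pts.erase x, (fun t => ((2 - 2 * t) ^ k)⁻¹) (inner ℝ x y) := by
    refine sum_congr rfl fun x hx => sum_congr rfl fun y hy => ?_
    exact norm_sub_rpow_neg_even (norm_pts x hx) (norm_pts y (mem_of_mem_erase hy)) k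
  rw [hconv]
  refine (energy_pts (fun t => ((2 - 2 * t) ^ k)⁻¹)).trans ?_
  norm_num

end SixPetersenSquare

/-- `dipValue 6 (2k)` in closed form: `14 (4^{-k} + 6 (7/3)^{-k} + 6 (5/3)^{-k})`. -/
theorem dipValue_six_even (k : ℕ) : dipValue 6 ((2 * k : ℕ) : ℝ) =
    14 * (((4 : ℝ) ^ k)⁻¹ + 6 * (((7 : ℝ) / 3) ^ k)⁻¹ + 6 * (((5 : ℝ) / 3) ^ k)⁻¹) := by
  have hp : 0 ≤ 2 + 2 / (6 : ℝ) := by norm_num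
  have hm : 0 ≤ 2 - 2 / (6 : ℝ) := by norm_num
  rw [dipValue]
  simp only [Nat.cast_ofNat]
  rw [sqrt_rpow_neg_even hp, sqrt_rpow_neg_even hm, Real.rpow_neg (by norm_num : (0 : ℝ) ≤ 2), Real.rpow_natCast,
    pow_mul]
  norm_num

/-- **`¬ DiploMinimises 6 6`**: for Riesz `s = 6`, `X_6` has energy `9933/400 = 24.8325 < dipValue 6 6 = 24.975…`. [cite: BallingerEtAl2009, §3.4] -/
theorem not_diploMinimises_six_six : ¬ DiploMinimises 6 6 := by
  intro h
  have hge := h SixPetersenSquare.pts SixPetersenSquare.card_pts SixPetersenSquare.norm_pts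
  have e6 : (6 : ℝ) = ((2 * 3 : ℕ) : ℝ) := by norm_num
  rw [e6, SixPetersenSquare.riesz_even_pts 3, dipValue_six_even 3] at hge
  norm_num at hge

/-- **`¬ DiploMinimises 6 8`**: for Riesz `s = 8`, `X_6` has energy `13.534625 < dipValue 6 8 = 13.7749…`. [cite: BallingerEtAl2009, §3.4] -/
theorem not_diploMinimises_six_eight : ¬ DiploMinimises 6 8 := by
  intro h
  have hge := h SixPetersenSquare.pts SixPetersenSquare.card_pts SixPetersenSquare.norm_pts
  have e8 : (8 : ℝ) = ((2 * 4 : ℕ) : ℝ) := by norm_num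
  rw [e8, SixPetersenSquare.riesz_even_pts 4, dipValue_six_even 4] at hge
  norm_num at hge

/-- **At the HARMONIC exponent `s = 4` the diplo-simplex `D_6` beats `X_6`**: `dipValue 6 4 = 46.5435… < 931/20 = 46.55 = E_4(X_6)`
(margin `0.0064`; BBCGKS's harmonic conjecture at `n = 6` survives this competitor). -/
theorem dipValue_six_four_lt_petersenSquare :
    dipValue 6 4 < ∑ x ∈ SixPetersenSquare.pts, ∑ y ∈ SixPetersenSquare.pts.erase x, ‖x - y‖ ^ (-(4 : ℝ)) := by
  have e4 : (4 : ℝ) = ((2 * 2 : ℕ) : ℝ) := by norm_num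
  rw [e4, SixPetersenSquare.riesz_even_pts 2, dipValue_six_even 2]
  norm_num

end Summit.Ventures.PackingBounds.Conjectures

end
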